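import Summits.QuantumFields.GaugeBoot.EquipartitionBound
import Summits.QuantumFields.GaugeBoot.LoopEquationPairForm
import HarnessLib

/-!
# Strong coupling from the loop equation, I: the one-step bound (gauge-boot, Lean layer, ADDENDUM 22 part A)

HONEST FRAMING (cell `pub-gaugeboot`, page 1 of every file): the venture produces certified bounds
on lattice expectations at stated coupling, gauge group, dimension and torus size; NOT a mass gap,
NOT a continuum limit, NOT a string tension; NOT Yang–Mills-summit-bearing (barriers
`FixedCouplingUltralocality`, `PerturbativeInvisibility`).  This file is an analytic STRONG-COUPLING
statement with explicit constants, valid for every torus side `L ≥ 2` and every real coupling; it is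
informative only for `|β|` small and certifies no number of the cell's tables.

## Content

The single-link loop equation of `LoopEquation.lean` (`loopEquation_of_sdPair`), read at a word `w`
whose split terms reduce to the marked letter (`Σ_k splitTerm_k(w) = (N − s/N)·tr ρ(hol w)`: the
marked edge is traversed exactly once, by the first letter), says

`(N − s/N)·E[tr ρ(hol w)] = −(β/2)·Σ_{ν ≠ μ, ε} E[plaqTerm_{ν,ε}(w)]`,

and every plaquette term is bounded by `2N(1 + |s|)` pointwise (`|tr ρ(g)| ≤ N` for unitary `ρ`).
Hence THE ONE-STEP BOUND (`0 ≤ s < N²`, `2(d−1)` plaquettes through a link):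

`|E[tr ρ(hol w)]| ≤ 2(d−1)(1+s)N²|β|/(N² − s)`,

i.e. `|⟨W(w)⟩_{β,L}| ≤ 2(d−1)|β|/N` for `U(N)` (`s = 0`) and `≤ 4(d−1)N|β|/(N² − 1)` for `SU(N)`
(`s = 1`), for EVERY `L`, every real `β` (tree coupling `β = β_std/N`) and every such word — the
strong-coupling twin of the unfreezing bound of `QuantitativeUnfreezingWords`.  For the plaquette
(`Equipartition.loopEquation_plaqWord`): `|⟨ū_P⟩_{β,L}| ≤ 4(d−1)N|β|/(N²−1)` (`SU(N)`, `N ≥ 2`,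
`L ≥ 2`), in the cell's normalisation `|plaquetteExpectation N D L β_std| ≤ 4(D−1)|β_std|/(N²−1)`
(`SU(3)`, `D = 4`: `≤ 3|β_std|/2`; `SU(2)`, `D = 4`: `≤ 4|β_std|`).  Parts B–D (files
`LoopEquationTwoWords`, `StrongCouplingPlaquetteUN`, `StrongCouplingPlaquetteSUN`) iterate once more and
pin the plaquette to `β/(2N) + O(β²)` with explicit constants.

References: Yu. Makeenko, *Methods of contemporary gauge theory* (2002), Problem 12.7 (iterative
strong-coupling solution of the lattice loop equation); M. Creutz, *Quarks, gluons and lattices*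
(1983) Ch. 10; P. Anderson, M. Kruczenski, Nucl. Phys. B 921 (2017) §2; V. Kazakov, Z. Zheng,
arXiv:2203.11360 §2.  Everything here is `[folklore]` given the tree's loop equation.
-/

noncomputable section

open MeasureTheory Filter Topology NormedSpace
open scoped Matrix.Norms.Frobenius Matrix
open Literature.MathematicalPhysics.QuantumFieldTheory
open Summit.QuantumFields.YangMills.Cruxes.CurvatureAmnesia.WardDefect.SchwingerDyson

namespace Summit.QuantumFields.GaugeBoot

namespace StrongCoupling

variable {d L N : ℕ} {G : Type} [Group G] {ρ : G →* Matrix (Fin N) (Fin N) ℂ}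

/-! ## Pointwise bounds -/

section Pointwise

variable [TopologicalSpace G] (r : LatticeRep G)

/-- `‖tr r.ρ(g)‖ ≤ N` for a lattice representation (unitary values: entries of modulus `≤ 1`). [folklore] -/
theorem norm_trace_le (g : G) : ‖(r.ρ g).trace‖ ≤ r.N := by
  calc ‖(r.ρ g).trace‖ = ‖∑ i, r.ρ g i i‖ := rfl
    _ ≤ ∑ i, ‖r.ρ g i i‖ := norm_sum_le _ _
    _ ≤ ∑ _i : Fin r.N, (1 : ℝ) := Finset.sum_le_sum fun i _ => entry_norm_bound_of_unitary (r.mem_unitary g) i i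
    _ = r.N := by simp

/-- `(a/N)·c ≤ a` for `0 ≤ a` and `c ≤ N` (also when `N = 0`). [folklore] -/
theorem div_mul_le_self {a c : ℝ} (ha : 0 ≤ a) (N : ℕ) (hc : c ≤ N) : a / N * c ≤ a := by
  rcases Nat.eq_zero_or_pos N with hN | hN
  · subst hN; simp [ha]
  · have hN' : (0 : ℝ) < N := by exact_mod_cast hN
    calc a / N * c ≤ a / N * N := by gcongr
      _ = a := div_mul_cancel₀ a hN'.ne'

/-- **Pointwise bound on a plaquette term**: `‖plaqTerm_{ν,ε}(w)‖ ≤ 2N(1 + ‖s‖)` — two single traces and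
`(s/N)·tr ρ(hol w)·(two traces)`, every trace of modulus `≤ N`. [folklore] -/
theorem norm_plaqTerm_le (s : ℂ) (x : Site d L) (μ : Fin d) (U : GaugeConfig d L G) (w : Word d) (ν : Fin d)
    (ε : Bool) : ‖plaqTerm r.ρ s x μ U w ν ε‖ ≤ 2 * r.N * (1 + ‖s‖) := by
  unfold plaqTerm
  have h1 := norm_trace_le r (wordHolonomy U x (w ++ plaqWord μ ν ε))
  have h2 := norm_trace_le r (wordHolonomy U x (w ++ (plaqWord μ ν ε).reverse))
  have h3 := norm_trace_le r (wordHolonomy U x w)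
  have h4 := norm_trace_le r (wordHolonomy U x (plaqWord μ ν ε))
  have h5 := norm_trace_le r (wordHolonomy U x (plaqWord μ ν ε).reverse)
  have hN : (0 : ℝ) ≤ r.N := Nat.cast_nonneg _
  have hA : ‖(r.ρ (wordHolonomy U x (w ++ plaqWord μ ν ε))).trace -
      (r.ρ (wordHolonomy U x (w ++ (plaqWord μ ν ε).reverse))).trace‖ ≤ 2 * r.N :=
    (norm_sub_le _ _).trans (by linarith)
  have hB : ‖s / (r.N : ℂ) * ((r.ρ (wordHolonomy U x w)).trace *
      ((r.ρ (wordHolonomy U x (plaqWord μ ν ε))).trace -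
        (r.ρ (wordHolonomy U x (plaqWord μ ν ε).reverse)).trace))‖ ≤ 2 * r.N * ‖s‖ := by
    rw [norm_mul, norm_mul, norm_div, Complex.norm_natCast]
    have hDE : ‖(r.ρ (wordHolonomy U x (plaqWord μ ν ε))).trace -
        (r.ρ (wordHolonomy U x (plaqWord μ ν ε).reverse)).trace‖ ≤ 2 * r.N :=
      (norm_sub_le _ _).trans (by linarith)
    have hsc : ‖s‖ / r.N * ‖(r.ρ (wordHolonomy U x w)).trace‖ ≤ ‖s‖ :=
      div_mul_le_self (norm_nonneg s) r.N h3
    calc ‖s‖ / r.N * (‖(r.ρ (wordHolonomy U x w)).trace‖ *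
          ‖(r.ρ (wordHolonomy U x (plaqWord μ ν ε))).trace -
            (r.ρ (wordHolonomy U x (plaqWord μ ν ε).reverse)).trace‖)
        = (‖s‖ / r.N * ‖(r.ρ (wordHolonomy U x w)).trace‖) *
          ‖(r.ρ (wordHolonomy U x (plaqWord μ ν ε))).trace -
            (r.ρ (wordHolonomy U x (plaqWord μ ν ε).reverse)).trace‖ := by ring
      _ ≤ ‖s‖ * (2 * r.N) :=
          mul_le_mul hsc hDE (norm_nonneg _) (norm_nonneg s)
      _ = 2 * r.N * ‖s‖ := by ring
  calc _ ≤ ‖(r.ρ (wordHolonomy U x (w ++ plaqWord μ ν ε))).trace -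
          (r.ρ (wordHolonomy U x (w ++ (plaqWord μ ν ε).reverse))).trace‖ +
        ‖s / (r.N : ℂ) * ((r.ρ (wordHolonomy U x w)).trace *
          ((r.ρ (wordHolonomy U x (plaqWord μ ν ε))).trace -
            (r.ρ (wordHolonomy U x (plaqWord μ ν ε).reverse)).trace))‖ := norm_sub_le _ _
    _ ≤ 2 * r.N + 2 * r.N * ‖s‖ := add_le_add hA hB
    _ = 2 * r.N * (1 + ‖s‖) := by ring

end Pointwise

/-! ## The one-step identity and the one-step bound (abstract lattice representation) -/

section OneStep

variable [TopologicalSpace G] [IsTopologicalGroup G] [CompactSpace G] [MeasurableSpace G] [BorelSpace G]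
  (r : LatticeRep G)

/-- The number of axes other than `μ`, as a real number: `d − 1`. [folklore] -/
theorem card_univ_erase_real (μ : Fin d) : ((Finset.univ.erase μ).card : ℝ) = (d : ℝ) - 1 := by
  rw [Finset.card_erase_of_mem (Finset.mem_univ μ), Finset.card_univ, Fintype.card_fin, Nat.cast_sub (Fin.pos μ),
    Nat.cast_one]

/-- **The expectation of a plaquette term is bounded by `2N(1 + ‖s‖)`** (Wilson's measure is a probability
measure). [folklore] -/
theorem norm_integral_plaqTerm_le [NeZero L] (β : ℝ) (s : ℂ) (x : Site d L) (μ : Fin d) (w : Word d) (ν : Fin d)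
    (ε : Bool) :
    ‖∫ U, plaqTerm r.ρ s x μ U w ν ε ∂(wilsonMeasure (d := d) (L := L) r.ρ β)‖ ≤ 2 * r.N * (1 + ‖s‖) := by
  haveI := isProbabilityMeasure_wilsonMeasure (d := d) (L := L) r.ρ r.continuous β
  have h := norm_integral_le_of_norm_le_const (μ := wilsonMeasure (d := d) (L := L) r.ρ β)
    (ae_of_all _ fun U => norm_plaqTerm_le r s x μ U w ν ε)
  rwa [probReal_univ, mul_one] at h

/-- **The summed plaquette terms are bounded by `2(d−1)·2·2N(1+‖s‖)`.** [folklore] -/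
theorem norm_sum_sum_integral_plaqTerm_le [NeZero L] (β : ℝ) (s : ℂ) (x : Site d L) (μ : Fin d) (w : Word d) :
    ‖∑ ν ∈ Finset.univ.erase μ, ∑ ε : Bool, ∫ U, plaqTerm r.ρ s x μ U w ν ε
        ∂(wilsonMeasure (d := d) (L := L) r.ρ β)‖ ≤ ((d : ℝ) - 1) * (2 * (2 * r.N * (1 + ‖s‖))) := by
  calc _ ≤ ∑ ν ∈ Finset.univ.erase μ, ‖∑ ε : Bool, ∫ U, plaqTerm r.ρ s x μ U w ν ε
          ∂(wilsonMeasure (d := d) (L := L) r.ρ β)‖ := norm_sum_le _ _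
    _ ≤ ∑ ν ∈ Finset.univ.erase μ, (2 * (2 * r.N * (1 + ‖s‖))) := by
        refine Finset.sum_le_sum fun ν _ => (norm_sum_le _ _).trans ?_
        calc ∑ ε : Bool, ‖∫ U, plaqTerm r.ρ s x μ U w ν ε ∂(wilsonMeasure (d := d) (L := L) r.ρ β)‖
            ≤ ∑ _ε : Bool, 2 * r.N * (1 + ‖s‖) := Finset.sum_le_sum fun ε _ => norm_integral_plaqTerm_le r β s x μ w ν ε
          _ = 2 * (2 * r.N * (1 + ‖s‖)) := by simp [two_mul]
    _ = ((d : ℝ) - 1) * (2 * (2 * r.N * (1 + ‖s‖))) := by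
        rw [Finset.sum_const, nsmul_eq_mul, card_univ_erase_real]

/-- **THE ONE-STEP IDENTITY.**  If the split terms of the closed word `w` at the edge `(x, μ)` reduce to the marked
letter — `Σ_k splitTerm_k(w) = (N − s/N)·tr ρ(hol w)` pointwise (the edge is traversed once, by the first letter) —
then the loop equation reads `(N − s/N)·E[tr ρ(hol w)] = −(β/2)·Σ_{ν≠μ,ε} E[plaqTerm_{ν,ε}(w)]`. [folklore] -/
theorem coeff_mul_integral_trace_eq [NeZero L] (β : ℝ) (x : Site d L) (μ : Fin d) (s : ℂ) (w : Word d)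
    (hw : Word.endpoint x w = x)
    (hsplit : ∀ U : GaugeConfig d L G, ∑ k ∈ Finset.range w.length, splitTerm r.ρ s x μ U w k =
      ((r.N : ℂ) - s / r.N) * (r.ρ (wordHolonomy U x w)).trace)
    (hP : ∀ i j : Fin r.N, SDPair r β x μ x w (unitDir s i j)) :
    ((r.N : ℂ) - s / r.N) * ∫ U, (r.ρ (wordHolonomy U x w)).trace ∂(wilsonMeasure (d := d) (L := L) r.ρ β) =
      -((β / 2 : ℂ) * ∑ ν ∈ Finset.univ.erase μ, ∑ ε : Bool,
        ∫ U, plaqTerm r.ρ s x μ U w ν ε ∂(wilsonMeasure (d := d) (L := L) r.ρ β)) := by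
  have h := loopEquation_of_sdPair r β x μ s w hw hP
  rw [← integral_finsetSum _ fun k _ => integrable_of_continuous r β (continuous_splitTerm r s x μ w k)] at h
  simp_rw [hsplit] at h
  rw [integral_const_mul] at h
  linear_combination h

/-- **THE ONE-STEP BOUND.**  Under the hypothesis of `coeff_mul_integral_trace_eq`, for a real weight
`0 ≤ s < N²`: `‖E[tr ρ(hol w)]‖ ≤ 2(d−1)(1+s)N²|β|/(N² − s)` — every loop reading the marked edge exactly once
(first) has expectation `O(β)` with an explicit, volume-independent constant. [folklore] -/
theorem norm_integral_trace_le [NeZero L] (β : ℝ) (x : Site d L) (μ : Fin d) {s : ℝ} (hs0 : 0 ≤ s)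
    (hsN : s < (r.N : ℝ) ^ 2) (w : Word d) (hw : Word.endpoint x w = x)
    (hsplit : ∀ U : GaugeConfig d L G, ∑ k ∈ Finset.range w.length, splitTerm r.ρ (s : ℂ) x μ U w k =
      ((r.N : ℂ) - (s : ℂ) / r.N) * (r.ρ (wordHolonomy U x w)).trace)
    (hP : ∀ i j : Fin r.N, SDPair r β x μ x w (unitDir (s : ℂ) i j)) :
    ‖∫ U, (r.ρ (wordHolonomy U x w)).trace ∂(wilsonMeasure (d := d) (L := L) r.ρ β)‖ ≤
      2 * ((d : ℝ) - 1) * (1 + s) * (r.N : ℝ) ^ 2 * |β| / ((r.N : ℝ) ^ 2 - s) := by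
  have hN0 : r.N ≠ 0 := by
    rintro h; rw [h] at hsN; simp at hsN; linarith
  have hNpos : (0 : ℝ) < r.N := by exact_mod_cast Nat.pos_of_ne_zero hN0
  set c : ℝ := (r.N : ℝ) - s / r.N with hc
  have hcpos : 0 < c := by
    rw [hc, sub_pos, div_lt_iff₀ hNpos, ← sq]; exact hsN
  have hcC : ((r.N : ℂ) - (s : ℂ) / r.N) = (c : ℂ) := by rw [hc]; push_cast; ring
  have h := coeff_mul_integral_trace_eq r β x μ (s : ℂ) w hw hsplit hP
  rw [hcC] at h
  have hn := congrArg (fun z : ℂ => ‖z‖) h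
  simp only [norm_mul, norm_neg, Complex.norm_real, Real.norm_eq_abs, abs_of_pos hcpos] at hn
  have hS := norm_sum_sum_integral_plaqTerm_le r β (s : ℂ) x μ w
  rw [Complex.norm_real, Real.norm_eq_abs, abs_of_nonneg hs0] at hS
  have hβ2 : ‖(β / 2 : ℂ)‖ = |β| / 2 := by
    rw [show (β / 2 : ℂ) = ((β / 2 : ℝ) : ℂ) by push_cast; ring, Complex.norm_real, Real.norm_eq_abs, abs_div,
      abs_two]
  rw [hβ2] at hn
  have hd1 : (0 : ℝ) ≤ (d : ℝ) - 1 := by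
    have : (1 : ℝ) ≤ d := by exact_mod_cast (Fin.pos μ)
    linarith
  -- `c·‖E tr‖ ≤ (|β|/2)·(d−1)·2·2N(1+s)`
  have hmain : c * ‖∫ U, (r.ρ (wordHolonomy U x w)).trace ∂(wilsonMeasure (d := d) (L := L) r.ρ β)‖ ≤
      |β| / 2 * (((d : ℝ) - 1) * (2 * (2 * r.N * (1 + s)))) := by
    rw [hn]; exact mul_le_mul_of_nonneg_left hS (by positivity)
  have hc' : c = ((r.N : ℝ) ^ 2 - s) / r.N := by rw [hc]; field_simp
  rw [le_div_iff₀ (by nlinarith [hcpos, hNpos] : (0 : ℝ) < (r.N : ℝ) ^ 2 - s)]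
  have hcN : c * r.N = (r.N : ℝ) ^ 2 - s := by rw [hc']; field_simp
  calc ‖∫ U, (r.ρ (wordHolonomy U x w)).trace ∂(wilsonMeasure (d := d) (L := L) r.ρ β)‖ * ((r.N : ℝ) ^ 2 - s)
      = (c * ‖∫ U, (r.ρ (wordHolonomy U x w)).trace ∂(wilsonMeasure (d := d) (L := L) r.ρ β)‖) * r.N := by
        rw [← hcN]; ring
    _ ≤ (|β| / 2 * (((d : ℝ) - 1) * (2 * (2 * r.N * (1 + s))))) * r.N :=
        mul_le_mul_of_nonneg_right hmain hNpos.le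
    _ = 2 * ((d : ℝ) - 1) * (1 + s) * (r.N : ℝ) ^ 2 * |β| := by ring

/-- **The one-step bound for the loop variable** `⟨W(w)⟩_{β,L} = (1/N) Re E[tr ρ(hol w)]`:
`|⟨W(w)⟩_{β,L}| ≤ 2(d−1)(1+s)N|β|/(N² − s)`. [folklore] -/
theorem abs_wilsonExpectation_wordLoop_le [NeZero L] (β : ℝ) (x : Site d L) (μ : Fin d) {s : ℝ} (hs0 : 0 ≤ s)
    (hsN : s < (r.N : ℝ) ^ 2) (w : Word d) (hw : Word.endpoint x w = x)
    (hsplit : ∀ U : GaugeConfig d L G, ∑ k ∈ Finset.range w.length, splitTerm r.ρ (s : ℂ) x μ U w k =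
      ((r.N : ℂ) - (s : ℂ) / r.N) * (r.ρ (wordHolonomy U x w)).trace)
    (hP : ∀ i j : Fin r.N, SDPair r β x μ x w (unitDir (s : ℂ) i j)) :
    |wilsonExpectation (d := d) (L := L) r.ρ β (wordLoop r.ρ x w)| ≤
      2 * ((d : ℝ) - 1) * (1 + s) * r.N * |β| / ((r.N : ℝ) ^ 2 - s) := by
  have hN0 : r.N ≠ 0 := by
    rintro h; rw [h] at hsN; simp at hsN; linarith
  have hNpos : (0 : ℝ) < r.N := by exact_mod_cast Nat.pos_of_ne_zero hN0
  have h := norm_integral_trace_le r β x μ hs0 hsN w hw hsplit hP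
  rw [wilsonExpectation_wordLoop_eq_re_integral_latticeRep r β x w, abs_mul, abs_inv, Nat.abs_cast]
  have hre := Complex.abs_re_le_norm
    (∫ U, (r.ρ (wordHolonomy U x w)).trace ∂(wilsonMeasure (d := d) (L := L) r.ρ β))
  calc (r.N : ℝ)⁻¹ * |(∫ U, (r.ρ (wordHolonomy U x w)).trace ∂(wilsonMeasure (d := d) (L := L) r.ρ β)).re|
      ≤ (r.N : ℝ)⁻¹ * (2 * ((d : ℝ) - 1) * (1 + s) * (r.N : ℝ) ^ 2 * |β| / ((r.N : ℝ) ^ 2 - s)) :=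
        mul_le_mul_of_nonneg_left (hre.trans h) (inv_nonneg.2 hNpos.le)
    _ = 2 * ((d : ℝ) - 1) * (1 + s) * r.N * |β| / ((r.N : ℝ) ^ 2 - s) := by
        field_simp

end OneStep

/-! ## `SU(N)` and `U(N)` -/

section Concrete

open Literature.MathematicalPhysics.QuantumLattice

variable [NeZero L]

/-- **One step, `SU(N)`** (`N ≥ 2`, fundamental representation, `s = 1`): if the split terms of the closed word `w`
at `(x, μ)` reduce to the marked letter, `‖E[tr hol w]‖ ≤ 4(d−1)N²|β|/(N²−1)` for every real `β` and every `L`.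
[folklore] -/
theorem norm_integral_trace_suN_le {N : ℕ} (hN : 2 ≤ N) (β : ℝ) (x : Site d L) (μ : Fin d) (w : Word d)
    (hw : Word.endpoint x w = x)
    (hsplit : ∀ U : GaugeConfig d L (Matrix.specialUnitaryGroup (Fin N) ℂ),
      ∑ k ∈ Finset.range w.length, splitTerm (fundamentalRep (Fin N)) 1 x μ U w k =
        ((N : ℂ) - 1 / N) * (fundamentalRep (Fin N) (wordHolonomy U x w)).trace) :
    ‖∫ U, (fundamentalRep (Fin N) (wordHolonomy U x w)).trace
        ∂(wilsonMeasure (d := d) (L := L) (fundamentalRep (Fin N)) β)‖ ≤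
      4 * ((d : ℝ) - 1) * (N : ℝ) ^ 2 * |β| / ((N : ℝ) ^ 2 - 1) := by
  have hN2 : (1 : ℝ) < ((fundamentalLatticeRep N).N : ℝ) ^ 2 := by
    rw [fundamentalLatticeRep_N]
    have : (2 : ℝ) ≤ N := by exact_mod_cast hN
    nlinarith
  have h := norm_integral_trace_le (d := d) (L := L) (fundamentalLatticeRep N) β x μ (s := 1) zero_le_one hN2 w hw
    (by intro U; rw [Complex.ofReal_one]; exact hsplit U)
    (fun i j => by rw [Complex.ofReal_one]; exact sdPair_specialUnitaryGroup N β x μ x w _ (trace_unitDir_one i j))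
  simp only [fundamentalLatticeRep_N] at h
  refine h.trans_eq ?_
  ring

/-- **One step, `U(N)`** (`N ≥ 1`, defining representation, `s = 0`): `‖E[tr hol w]‖ ≤ 2(d−1)|β|` — no `N` at
all. [folklore] -/
theorem norm_integral_trace_uN_le {N : ℕ} (hN : 1 ≤ N) (β : ℝ) (x : Site d L) (μ : Fin d) (w : Word d)
    (hw : Word.endpoint x w = x)
    (hsplit : ∀ U : GaugeConfig d L (Matrix.unitaryGroup (Fin N) ℂ),
      ∑ k ∈ Finset.range w.length, splitTerm (unitaryFundamentalRep (Fin N) ℂ) 0 x μ U w k =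
        (N : ℂ) * (unitaryFundamentalRep (Fin N) ℂ (wordHolonomy U x w)).trace) :
    ‖∫ U, (unitaryFundamentalRep (Fin N) ℂ (wordHolonomy U x w)).trace
        ∂(wilsonMeasure (d := d) (L := L) (unitaryFundamentalRep (Fin N) ℂ) β)‖ ≤ 2 * ((d : ℝ) - 1) * |β| := by
  have hNpos : (0 : ℝ) < N := by exact_mod_cast hN
  have hN2 : (0 : ℝ) < ((unitaryFundamentalLatticeRep N).N : ℝ) ^ 2 := by
    rw [unitaryFundamentalLatticeRep_N]; positivity
  have h := norm_integral_trace_le (d := d) (L := L) (unitaryFundamentalLatticeRep N) β x μ (s := 0) le_rfl hN2 w hw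
    (by intro U; rw [Complex.ofReal_zero, zero_div, sub_zero]; exact hsplit U)
    (fun i j => by rw [Complex.ofReal_zero]; exact sdPair_unitaryGroup N β x μ x w _)
  simp only [unitaryFundamentalLatticeRep_N, add_zero, sub_zero] at h
  refine h.trans_eq ?_
  field_simp

/-- ★ **The plaquette at strong coupling, first order, `SU(N)`**: for `N ≥ 2`, `d ≥ 2`, every `L ≥ 2` and EVERY real
`β` (tree coupling): `|⟨ū_P⟩_{β,L}| ≤ 4(d−1)N|β|/(N² − 1)`. [folklore] -/
theorem abs_wilsonExpectation_meanPlaquette_suN_le {N : ℕ} (hN : 2 ≤ N) (hL : (1 : ZMod L) ≠ 0) (hd : 2 ≤ d)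
    (β : ℝ) :
    |wilsonExpectation (fundamentalRep (Fin N)) β
        (meanPlaquette (d := d) (L := L) (G := Matrix.specialUnitaryGroup (Fin N) ℂ) (fundamentalRep (Fin N)))| ≤
      4 * ((d : ℝ) - 1) * N * |β| / ((N : ℝ) ^ 2 - 1) := by
  obtain ⟨μ, ν, hμν⟩ : ∃ μ ν : Fin d, μ ≠ ν := ⟨⟨0, by omega⟩, ⟨1, by omega⟩, by simp [Fin.ext_iff]⟩
  have hN0 : N ≠ 0 := by omega
  have hNpos : (0 : ℝ) < N := by exact_mod_cast Nat.pos_of_ne_zero hN0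
  have hN2 : (0 : ℝ) < (N : ℝ) ^ 2 - 1 := by
    have : (2 : ℝ) ≤ N := by exact_mod_cast hN
    nlinarith
  set x : Site d L := fun _ => 0
  have h := norm_integral_trace_suN_le (d := d) (L := L) hN β x μ (plaqWord μ ν true) (endpoint_plaqWord x μ ν true)
    (fun U => by simpa using Equipartition.sum_splitTerm_plaqWord (fundamentalRep (Fin N)) hL 1 x hμν U true)
  have hre := Equipartition.integral_re_trace_plaqWord (d := d) (L := L) (fundamentalLatticeRep N) β x hμν true
    (by rw [fundamentalLatticeRep_N]; exact hN0)
  have hre0 := Equipartition.re_integral_eq (fundamentalLatticeRep N) β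
    (continuous_trace_wordHolonomy (fundamentalLatticeRep N) x (plaqWord μ ν true))
  simp only [fundamentalLatticeRep_N, fundamentalLatticeRep_ρ] at hre hre0
  rw [← hre0] at hre
  have hb : |(N : ℝ) * wilsonExpectation (fundamentalRep (Fin N)) β
      (meanPlaquette (d := d) (L := L) (G := Matrix.specialUnitaryGroup (Fin N) ℂ) (fundamentalRep (Fin N)))| ≤
      4 * ((d : ℝ) - 1) * (N : ℝ) ^ 2 * |β| / ((N : ℝ) ^ 2 - 1) := by
    rw [← hre]; exact (Complex.abs_re_le_norm _).trans h
  rw [abs_mul, Nat.abs_cast] at hb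
  have key : |wilsonExpectation (fundamentalRep (Fin N)) β
      (meanPlaquette (d := d) (L := L) (G := Matrix.specialUnitaryGroup (Fin N) ℂ) (fundamentalRep (Fin N)))| ≤
      (4 * ((d : ℝ) - 1) * (N : ℝ) ^ 2 * |β| / ((N : ℝ) ^ 2 - 1)) / N := by
    rw [le_div_iff₀ hNpos, mul_comm]; exact hb
  refine key.trans_eq ?_
  field_simp

/-- ★ **The plaquette at strong coupling, first order, `U(N)`** (`N ≥ 1`, `d ≥ 2`, `L ≥ 2`, every real `β`):
`|⟨ū_P⟩_{β,L}| ≤ 2(d−1)|β|/N`. [folklore] -/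
theorem abs_wilsonExpectation_meanPlaquette_uN_le {N : ℕ} (hN : 1 ≤ N) (hL : (1 : ZMod L) ≠ 0) (hd : 2 ≤ d)
    (β : ℝ) :
    |wilsonExpectation (unitaryFundamentalRep (Fin N) ℂ) β
        (meanPlaquette (d := d) (L := L) (G := Matrix.unitaryGroup (Fin N) ℂ) (unitaryFundamentalRep (Fin N) ℂ))| ≤
      2 * ((d : ℝ) - 1) * |β| / N := by
  obtain ⟨μ, ν, hμν⟩ : ∃ μ ν : Fin d, μ ≠ ν := ⟨⟨0, by omega⟩, ⟨1, by omega⟩, by simp [Fin.ext_iff]⟩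
  have hN0 : N ≠ 0 := by omega
  have hNpos : (0 : ℝ) < N := by exact_mod_cast Nat.pos_of_ne_zero hN0
  set x : Site d L := fun _ => 0
  have h := norm_integral_trace_uN_le (d := d) (L := L) hN β x μ (plaqWord μ ν true) (endpoint_plaqWord x μ ν true)
    (fun U => by simpa using Equipartition.sum_splitTerm_plaqWord (unitaryFundamentalRep (Fin N) ℂ) hL 0 x hμν U true)
  have hre := Equipartition.integral_re_trace_plaqWord (d := d) (L := L) (unitaryFundamentalLatticeRep N) β x hμν true
    (by rw [unitaryFundamentalLatticeRep_N]; exact hN0)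
  have hre0 := Equipartition.re_integral_eq (unitaryFundamentalLatticeRep N) β
    (continuous_trace_wordHolonomy (unitaryFundamentalLatticeRep N) x (plaqWord μ ν true))
  simp only [unitaryFundamentalLatticeRep_N, unitaryFundamentalLatticeRep_ρ] at hre hre0
  rw [← hre0] at hre
  have hb : |(N : ℝ) * wilsonExpectation (unitaryFundamentalRep (Fin N) ℂ) β
      (meanPlaquette (d := d) (L := L) (G := Matrix.unitaryGroup (Fin N) ℂ) (unitaryFundamentalRep (Fin N) ℂ))| ≤
      2 * ((d : ℝ) - 1) * |β| := by
    rw [← hre]; exact (Complex.abs_re_le_norm _).trans h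
  rw [abs_mul, Nat.abs_cast] at hb
  rw [le_div_iff₀ hNpos, mul_comm]
  exact hb

/-- ★ **The cell's form, first order.**  For `SU(N)`, `N ≥ 2`, `D ≥ 2`, every torus side `L ≥ 2` and EVERY real
standard coupling `β_std`: `|plaquetteExpectation N D L β_std| ≤ 4(D−1)|β_std|/(N² − 1)` — the plaquette is `O(β)`
at strong coupling with an explicit, volume-independent constant (one loop-equation step). [folklore] -/
theorem abs_plaquetteExpectation_le {N D L : ℕ} [NeZero L] (hN : 2 ≤ N) (hL : 2 ≤ L) (hD : 2 ≤ D) (β : ℝ) :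
    |plaquetteExpectation N D L β| ≤ 4 * ((D : ℝ) - 1) * |β| / ((N : ℝ) ^ 2 - 1) := by
  have hNpos : (0 : ℝ) < N := by
    have : (2 : ℝ) ≤ N := by exact_mod_cast hN
    linarith
  have h := abs_wilsonExpectation_meanPlaquette_suN_le (d := D) (L := L) hN (zmod_one_ne_zero hL) hD (β / N)
  unfold plaquetteExpectation
  refine h.trans (le_of_eq ?_)
  rw [abs_div, Nat.abs_cast]
  field_simp

/-- `T4` (`SU(3)`, `D = 4`): `|plaquetteExpectation 3 4 L β_std| ≤ 3|β_std|/2` for every `L ≥ 2` and every real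
`β_std`. [folklore] -/
theorem abs_plaquetteExpectation_three_four_le {L : ℕ} [NeZero L] (hL : 2 ≤ L) (β : ℝ) :
    |plaquetteExpectation 3 4 L β| ≤ 3 * |β| / 2 := by
  have h := abs_plaquetteExpectation_le (N := 3) (D := 4) (L := L) (by norm_num) hL (by norm_num) β
  norm_num at h
  linarith

/-- `T3` (`SU(3)`, `D = 3`): `|plaquetteExpectation 3 3 L β_std| ≤ |β_std|`. [folklore] -/
theorem abs_plaquetteExpectation_three_three_le {L : ℕ} [NeZero L] (hL : 2 ≤ L) (β : ℝ) :
    |plaquetteExpectation 3 3 L β| ≤ |β| := by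
  have h := abs_plaquetteExpectation_le (N := 3) (D := 3) (L := L) (by norm_num) hL (by norm_num) β
  norm_num at h
  linarith

/-- `T2` (`SU(2)`, `D = 4`): `|plaquetteExpectation 2 4 L β_std| ≤ 4|β_std|`. [folklore] -/
theorem abs_plaquetteExpectation_two_four_le {L : ℕ} [NeZero L] (hL : 2 ≤ L) (β : ℝ) :
    |plaquetteExpectation 2 4 L β| ≤ 4 * |β| := by
  have h := abs_plaquetteExpectation_le (N := 2) (D := 4) (L := L) le_rfl hL (by norm_num) β
  norm_num at h
  linarith

/-- `T1` (`SU(2)`, `D = 3`): `|plaquetteExpectation 2 3 L β_std| ≤ 8|β_std|/3`. [folklore] -/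
theorem abs_plaquetteExpectation_two_three_le {L : ℕ} [NeZero L] (hL : 2 ≤ L) (β : ℝ) :
    |plaquetteExpectation 2 3 L β| ≤ 8 * |β| / 3 := by
  have h := abs_plaquetteExpectation_le (N := 2) (D := 3) (L := L) le_rfl hL (by norm_num) β
  norm_num at h
  linarith

end Concrete

end StrongCoupling

end Summit.QuantumFields.GaugeBoot

end
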